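import Summits.BirchSwinnertonDyer.BirchSwinnertonDyer.Theorems.ClassRecordThreeCornerAtThreeUpperModEight
import Summits.BirchSwinnertonDyer.BirchSwinnertonDyer.Theorems.ClassRecordThreeCornerAtThreeUpperHybrid
import Summits.BirchSwinnertonDyer.Rank1Residual.X11b.BDPRouteOddPrime
import HarnessLib

/-!
# Route `ClassRecordThree` (rung K2@3), crux `CornerAtThree` (item stmt-BirchSwinnertonDyer-19111; twin 21420 `CornerAtThreeW`),
# line of record `Cruxes/CornerAtThree/Lines/inert.lean`: the MONO-carrier branch of the residual binder `residual3_of_stubs`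
# (`Typed.MissingUpperBoundAt W 3`) KEYED ON PRINT — the booked Heegner frame has `d_K ≡ 1 (mod 8)`, so the Jetchev MAX form is
# needed there only, where it stands on {Gross 3.7 (2) (A′), Poitou–Tate, [GZ86 III (3.1)] image-free}
# (cell `bsd-stepL`, seat `bsd-stepL-corner-p1` g12; `--supports stmt-BirchSwinnertonDyer-19111`)

WHY THIS FILE (companion of `…UpperModEight`). The line of record consumes lane A's stub `stub_upper3_jetchevMaxMono` (the Jetchev MAX
form at `3` on ALL odd-`d_K` Heegner frames of a mono-carrier corner curve) in exactly one place: `residual3_of_stubs`, through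
`Koly.cornerUpperAt_of_jetchevMaxAt_of_monoCarrier` and x11b3's `Three.missingUpperBoundAt_of_cornerUpperAt`, to get the consumed
shape `Typed.MissingUpperBoundAt W 3`. That consumer books ONE frame per curve — the field of `X11b.exists_oddHeegnerData`, which is
Hoffstein–Luo's (`HoffsteinLuo1997_exists_twist_L_one_ne_zero`: `d % 8 = 1` BY STATEMENT). This file re-runs the consumer keeping
that congruence (§1 `exists_admissibleFieldModEight_of_rootNumber_eq_neg_one`, `exists_modEightHeegnerData` — the supply theorems
with `NumberField.discr K % 8 = 1` EXPORTED, proofs verbatim), and books the frame against the MAX form ON `d_K ≡ 1 (mod 8)` FRAMES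
ONLY (§2 `missingUpperBoundAt_of_jetchevMaxModEightAt_of_irreducible`: Darmon's conductor-1 datum, `P_1 = y_K`, rank one, no
`3`-torsion, lane A's `shaIndexBound_sharp_of_globalDivisibility_of_irreducible`, then `missingUpperBoundAt_of_shaIndexBound_sharp`
with the twin's `≥`-half from `CornerTwistAt W`). With `…UpperModEight` §4 this gives (§3):

**`missingUpperBoundAt_monoCarrier_of_threeNamedFacts_of_facts` — on every MONO-carrier (T4″)@3 corner curve (`ClassX11b W 3`,
`¬ Surj W 3`, `3 ∣ ∏c`, `∃ v, ord₃ ∏c ≤ ord₃ c_v`), `Typed.MissingUpperBoundAt W 3` ⟸ {(A′) `GrossLMS1991.prop37_2_frobeniusCongruence`,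
Poitou–Tate, GZ III (3.1) image-free} ∪ {the consumer's cited facts: Gross–Zagier, Kolyvagin, GZK, modularity ×2, Hoffstein–Luo,
Mazur–Manin, Shimura reciprocity at conductor 1, Darmon 3.6, Cha Rmk 25} ∪ {`CornerTwistAt W` = conjunct 2, the twist stubs' object}.**
No (γ)-twin def, no `h2` residue, no `ℓ = 2` input of any kind: ARM P's «SMUGGLED-by-display CANDIDATE» at the booking of 19111 ∕ 21420
through p563330 ∕ p563499 ∕ p563825 (R-44, relay 39 ∕ 40) is VOID for the mono-carrier branch — the booking frame supplies I-Q65-13 (b)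
`d_K ≡ 1 (mod 8)`. (For the planner: re-key `stub_upper3_jetchevMaxMono` with the one extra binder `NumberField.discr K % 8 = 1` —
`…UpperModEight` §4 gives its body from the three print facts — and replace the mono branch of `residual3_of_stubs` by §2 here.)

HONEST FRAMING: theorems only (no definition, no named fact, no `sorry`); everything is CONDITIONAL on NAMED, published, typed,
unformalised Literature facts listed as binders and on the hypothesis-SHAPED open input `CornerTwistAt W`; no stub is discharged;
19111 ∕ 21420 stay OPEN; nothing about any curve's BSD; BSD is not advanced; T7. Credit: x11b3 (the consumer, `BDPRouteOddPrime`,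
`JetchevShapeOverK`), lane A g2 (the structure-theorem kernel), corner3-p2 (the line), print-x9, ARM P r05.
References (locators only): [cite: HoffsteinLuo1997, Theorem (§1, pp. 435–436)] [cite: GrossLMS1991, Prop. 3.7 (2)] [cite: Cha2005, Rmk. 25]
[cite: MatarNekovar2019, Thm. 0.7, §0.11] [cite: Darmon2004, Thm. 3.6] [cite: Jetchev2008, Thm. 1.4, Cor. 1.5]
[cite: JetchevSkinnerWan2017, §7.4.2 (eq:shaupper)] [cite: GrossZagier1986, I (6.5), III (3.1)].
-/

set_option autoImplicit false
set_option linter.dupNamespace false -- `Summit.BirchSwinnertonDyer.BirchSwinnertonDyer` (summit = problem), tree-wide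

noncomputable section

open scoped Classical NumberField

/-! ### §1 The supply with `d_K ≡ 1 (mod 8)` exported -/

namespace Summit.BirchSwinnertonDyer.Rank1Residual.X11b

open WeierstrassCurve NumberField Literature.NumberTheory.EllipticCurves
  Literature.NumberTheory.EllipticCurves.ModularForms
  Literature.NumberTheory.EllipticCurves.Rank1Residual

/-- **Hoffstein–Luo's admissible field, with `d_K ≡ 1 (mod 8)` exported** — the Literature theorem
`exists_admissibleField_of_rootNumber_eq_neg_one` (whose proof already runs through `d % 8 = 1`) re-run keeping that conjunct:
for `w(E) = −1` and a prime `p` there is an imaginary quadratic `K` with `d_K` odd, `d_K ≡ 1 (mod 8)`, `d_K < −4`, Heegner for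
`N_E` and for `p`, and `L(E^{(d_K)}, 1) ≠ 0`. CONDITIONAL on `hmod`, `hHL`. [cite: HoffsteinLuo1997, Theorem (§1, pp. 435–436)] -/
theorem exists_admissibleFieldModEight_of_rootNumber_eq_neg_one (hmod : exists_isNewformOf)
    (hHL : HoffsteinLuo1997_exists_twist_L_one_ne_zero) (W : WeierstrassCurve ℚ) [W.IsElliptic]
    (hw : W.rootNumber = -1) (p : ℕ) [Fact p.Prime] :
    ∃ (K : Type) (_ : Field K) (_ : NumberField K), IsImaginaryQuadratic K ∧
      Odd (NumberField.discr K) ∧ NumberField.discr K % 8 = 1 ∧ NumberField.discr K < -4 ∧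
      SatisfiesHeegnerHypothesis (W.conductorNorm ℤ) K ∧ SatisfiesHeegnerHypothesis p K ∧
        (W.quadraticTwist (NumberField.discr K : ℚ)).entireLFunction 1 ≠ 0 := by
  have hpP : p.Prime := Fact.out
  obtain ⟨d, hdneg, hsq, hd8, hB, hjacS, hjacN, hL⟩ :=
    exists_neg_fundamental_twist_ne_zero_of_hoffsteinLuo hmod hHL W hw {p} 4
  -- the character conditions at the primes of `N_E · p`
  have hkr : ∀ q : ℕ, q.Prime → q ∣ W.conductorNorm ℤ * p →
      (q = 2 → d % 8 = 1) ∧ (q ≠ 2 → jacobiSym d q = 1) := by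
    intro q hq hqNp
    refine ⟨fun _ ↦ hd8, fun hq2 ↦ ?_⟩
    rcases (Nat.Prime.dvd_mul hq).mp hqNp with hqN | hqp
    · exact hjacN q hq hqN hq2
    · have hqp' : q = p := (Nat.prime_dvd_prime_iff_eq hq hpP).mp hqp
      subst hqp'
      exact hjacS q (Finset.mem_singleton_self q) hq hq2
  -- the field `K = ℚ(√d)`, `d_K = d ≡ 1 (mod 8)`, `|d_K| > 4`
  obtain ⟨K, _, _, hK, hBK, hH, hd8K, hLK⟩ :=
    (exists_heegnerField_iff_exists_fundamental (W.conductorNorm ℤ * p) 4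
      (fun D ↦ D % 8 = 1 ∧ (W.quadraticTwist (D : ℚ)).entireLFunction 1 ≠ 0)).mpr
      ⟨d, hdneg, Or.inl ⟨by omega, hsq, by omega⟩, hB, hkr, hd8, hL⟩
  have hneg : NumberField.discr K < 0 := IsImaginaryQuadratic.discr_neg hK
  refine ⟨K, inferInstance, inferInstance, hK, Int.odd_iff.mpr (by omega), hd8K, ?_,
    hH.of_dvd (dvd_mul_right _ _), hH.of_dvd (dvd_mul_left _ _), hLK⟩
  have h4 : 4 < (NumberField.discr K).natAbs := hBK
  omega

/-- **The Manin-good Heegner datum at an odd multiplicative prime, with `d_K ≡ 1 (mod 8)` exported** — x11b3's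
`exists_oddHeegnerData` re-run on `exists_admissibleFieldModEight_of_rootNumber_eq_neg_one` (proof verbatim otherwise): the
Hoffstein–Luo field, the Manin-unit parametrisation datum (`p ∤ c`), the Heegner point, `p ∤ w_K`, the non-vanishing twist and a
globally minimal model of it. CONDITIONAL on `hnf`, `hHL`, `hMaz`, `hNS`. [cite: HoffsteinLuo1997, Theorem (§1)]
[cite: Mazur1978, Cor. 4.1] [cite: GrossZagier1986, I (6.5)] -/
theorem exists_modEightHeegnerData (hnf : exists_isNewformOf)
    (hHL : HoffsteinLuo1997_exists_twist_L_one_ne_zero)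
    (hMaz : mazur_not_dvd_maninConstant_of_odd) (hNS : integral_neronScaling_of_isGloballyMinimal)
    (W : WeierstrassCurve ℚ) [W.IsElliptic] [W.IsGloballyMinimal] (p : ℕ) [Fact p.Prime]
    [NeZero (W.conductorNorm ℤ)]
    (hr : W.analyticRank = 1) (hp2 : p ≠ 2) (hmult : Mult W p) (hirr : Irr W p) :
    ∃ (K : Type) (_ : Field K) (_ : NumberField K)
      (Dt : ModularParametrizationData W (W.conductorNorm ℤ))
      (H : HeegnerDatum (W.conductorNorm ℤ) (NumberField.discr K)) (ι : K →+* ℂ)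
      (P : (W.baseChange K).toAffine.Point)
      (Wd : WeierstrassCurve ℚ) (_ : Wd.IsElliptic) (_ : Wd.IsGloballyMinimal) (Cd : VariableChange ℚ),
      IsImaginaryQuadratic K ∧ Odd (NumberField.discr K) ∧ NumberField.discr K % 8 = 1 ∧
        ¬ (p : ℤ) ∣ NumberField.discr K ∧
        SatisfiesHeegnerHypothesis (W.conductorNorm ℤ) K ∧
        WeierstrassCurve.Affine.Point.map ι.toRatAlgHom P = heegnerPointComplex Dt H ∧
        ¬ (p : ℤ) ∣ Dt.c ∧ ¬ p ∣ Units.torsionOrder K ∧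
        (W.quadraticTwist (NumberField.discr K : ℚ)).entireLFunction 1 ≠ 0 ∧
        Cd • W.quadraticTwist (NumberField.discr K : ℚ) = Wd := by
  have hp : p.Prime := Fact.out
  -- the sign of the functional equation is `−1` (modularity, `r_an = 1`)
  have hw : W.rootNumber = -1 := by
    rw [WeierstrassCurve.rootNumber_eq_neg_one_pow_analyticRank_of_exists_isNewformOf hnf W, hr]
    norm_num
  -- the Hoffstein–Luo field: `d_K ≡ 1 (mod 8)`, `d_K < −4`, every `ℓ ∣ N` and `p` split
  obtain ⟨K, _, _, hK, hodd, hd8, hlt, hHN, hHp, hLt⟩ :=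
    exists_admissibleFieldModEight_of_rootNumber_eq_neg_one hnf hHL W hw p
  have hpd : ¬ (p : ℤ) ∣ NumberField.discr K := not_dvd_discr_of_split hK hp hp2 hHp
  -- `w_K = 2`, prime to the odd prime `p`
  have hμ : ¬ p ∣ Units.torsionOrder K := by
    haveI : IsTotallyComplex K := hK.2
    rw [Literature.NumberTheory.DiophantineGeometry.torsionOrder_eq_two_of_discr_lt hK.1 hlt]
    intro h2
    have := Nat.le_of_dvd two_pos h2
    have := hp.two_le
    omega
  -- the Heegner datum with `p ∤ c`
  obtain ⟨Dt, H, ι, P, hP, hc⟩ :=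
    exists_maninDatum_of_odd hnf hMaz hNS W p (W.conductorNorm ℤ) K rfl hp2 hmult hirr hK hHN
  -- a globally minimal model of the twist
  have hD0 : (NumberField.discr K : ℚ) ≠ 0 := by exact_mod_cast NumberField.discr_ne_zero K
  haveI hEt : (W.quadraticTwist (NumberField.discr K : ℚ)).IsElliptic :=
    W.isElliptic_quadraticTwist hD0
  obtain ⟨Cd, hCd⟩ := hasGlobalMinimalModel_rat_holds (W.quadraticTwist (NumberField.discr K : ℚ))
  exact ⟨K, inferInstance, inferInstance, Dt, H, ι, P, Cd • W.quadraticTwist (NumberField.discr K : ℚ),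
    inferInstance, hCd, Cd, hK, hodd, hd8, hpd, hHN, hP, hc, hμ, hLt, rfl⟩

end Summit.BirchSwinnertonDyer.Rank1Residual.X11b

/-! ### §2 The consumed shape from the Jetchev MAX form on `d_K ≡ 1 (mod 8)` frames -/

namespace Summit.BirchSwinnertonDyer.Rank1Residual.X11b.Three

open WeierstrassCurve IsDedekindDomain NumberField Literature.NumberTheory.EllipticCurves
  Literature.NumberTheory.EllipticCurves.ModularForms
  Literature.NumberTheory.EllipticCurves.Rank1Residual
  Literature.NumberTheory.EllipticCurves.Rank1Residual.Typed
  Literature.NumberTheory.GaloisRepresentations Literature.NumberTheory.GaloisCohomology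
  Summit.BirchSwinnertonDyer.Rank1Residual Summit.BirchSwinnertonDyer.Rank1Residual.X11b

/-- **`Typed.MissingUpperBoundAt W 3` on a (T4″)@3 corner curve from the Jetchev direction AT THE BOOKED FRAME ONLY —
a frame with `d_K ≡ 1 (mod 8)`** (`hJW8`: on every Manin-good conductor-`N_E` frame `(Dt, β, ι)` over an imaginary quadratic Heegner
field with `d_K` odd AND `d_K ≡ 1 (mod 8)`, every derived Heegner point at Kolyvagin levels of index `≥ s` is `3^s`-divisible for all
`s ≤ ord₃ ∏c`), together with conjunct 2 `CornerTwistAt W`. Proof = x11b3's `missingUpperBoundAt_of_cornerUpperAt` with the supply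
`exists_modEightHeegnerData` (same field, the congruence kept) and, in place of `CornerUpperAt W`, the body of
`Koly.cornerUpperAt_of_jetchevDivisibilityAt_of_irreducible` at that one frame (Darmon's conductor-1 datum, `P_1 = y_K = P`, rank one,
no `3`-torsion, lane A's `shaIndexBound_sharp_of_globalDivisibility_of_irreducible`). PUBLISHED binders: Gross–Zagier, Kolyvagin, GZK,
modularity (`hmod`, `hnf`), Hoffstein–Luo, Mazur–Manin, Shimura reciprocity at conductor 1, Darmon 2004 Thm. 3.6, and the structure
fact `hChaU` (flag `Cha05-Rmk25-structure`). CONDITIONAL on all of them, on `hJW8` and on `hTw`; nothing booked.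
[cite: HoffsteinLuo1997, Theorem (§1)] [cite: Cha2005, Thm. 21, Rmk. 25] [cite: Darmon2004, Thm. 3.6] [cite: Jetchev2008, Cor. 1.5 (shape)]
[cite: JetchevSkinnerWan2017, §7.4.2 (eq:shaupper)] -/
theorem missingUpperBoundAt_of_jetchevMaxModEightAt_of_irreducible [Fact (Nat.Prime 3)]
    (hGZ : ∀ (N : ℕ) [NeZero N] (W : WeierstrassCurve ℚ) (K : Type) [Field K] [NumberField K],
      gross_zagier N W K)
    (hKo : ∀ (N : ℕ) [NeZero N] (W : WeierstrassCurve ℚ) (K : Type) [Field K] [NumberField K],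
      kolyvagin N W K)
    (hGZK : rank_eq_analyticRank_of_analyticRank_le_one) (hmod : hasEntireLFunction_rat)
    (hnf : exists_isNewformOf) (hHL : HoffsteinLuo1997_exists_twist_L_one_ne_zero)
    (hMaz : mazur_not_dvd_maninConstant_of_odd)
    (hrec : ∀ (N : ℕ) [NeZero N] (W : WeierstrassCurve ℚ) (K : Type) [Field K] [NumberField K],
      heegnerPointOfConductor_one_galoisConj N W K)
    (hD36 : ∀ (N : ℕ) [NeZero N] (W : WeierstrassCurve ℚ) (K : Type) [Field K] [NumberField K],
      phi_heegnerTau_mem_singularModuliField N W K)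
    (hChaU : Cha2005.rmk25_padicValNat_card_sha_primary_add_le_of_globalDivisibility)
    (W : WeierstrassCurve ℚ) [W.IsElliptic] [W.IsGloballyMinimal] (hX : ClassX11b W 3)
    (hns : ¬ Surj W 3)
    (hJW8 : ∀ [NeZero (W.conductorNorm ℤ)] (K : Type) [Field K] [NumberField K]
      (Dt : ModularParametrizationData W (W.conductorNorm ℤ)) (β : ℤ) (ι : K →+* ℂ),
      ClassX11b W 3 → ¬ Surj W 3 →
      IsImaginaryQuadratic K → SatisfiesHeegnerHypothesis (W.conductorNorm ℤ) K →
      Odd (NumberField.discr K) → NumberField.discr K % 8 = 1 →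
      (4 * (W.conductorNorm ℤ : ℤ)) ∣ β ^ 2 - NumberField.discr K → ¬ (3 : ℤ) ∣ Dt.c →
      ∀ (s : ℕ), s ≤ padicValNat 3 W.tamagawaProduct →
        ∀ (n : ℕ) (d : KolyvaginHeegnerData Dt β ι n), Squarefree n →
          (∀ ℓ ∈ n.primeFactors, Zhang2014.IsKolyvaginPrime (W.conductorNorm ℤ) W K 3 ℓ ∧
            s ≤ Zhang2014.kolyvaginIndex W 3 ℓ) → Koly.PDiv d 3 s)
    (hTw : CornerTwistAt W) :
    Typed.MissingUpperBoundAt W 3 := by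
  have hNS : integral_neronScaling_of_isGloballyMinimal :=
    integral_neronScaling_of_isGloballyMinimal_holds
  obtain ⟨hr, hp2, hmult, hirr⟩ := id hX
  haveI : NeZero (W.conductorNorm ℤ) := ⟨(W.conductorNorm_pos_holds).ne'⟩
  obtain ⟨K, _, _, Dt, H, ι, P, Wd, _, _, Cd, hK, hodd, hd8, hpd, hHN, hP, hc, hμ, hLt, hWd⟩ :=
    exists_modEightHeegnerData hnf hHL hMaz hNS W 3 hr hp2 hmult hirr
  have htam : padicValNat 3 Wd.tamagawaProduct = padicValNat 3 W.tamagawaProduct :=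
    X2.padicValNat_tamagawaProduct_twist_of_heegner_of_odd W 3 hp2 K hK hodd hpd hHN Cd hWd
  have hu : padicValRat 3 (Cd.u : ℚ) = 0 :=
    padicValRat_u_eq_zero_of_twist_minimal W 3 K hK hHN hmult Cd hWd
  obtain ⟨qd, hqd, hv⟩ :=
    pPartRankZero_of_cornerTwistAt hmod hGZK W hX hns hTw K Wd Cd hK hodd hHN hLt hWd
  refine missingUpperBoundAt_of_shaIndexBound_sharp W 3 (W.conductorNorm ℤ) K Dt H ι P (hGZ _ W K)
    (hKo _ W K) hGZK hmod hK hHN hP hp2 hc hμ hr hLt Wd Cd hWd hu htam le_rfl ⟨qd, hqd, hv.le⟩ ?_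
  -- the SHARP bound over `K` at THIS frame, from the Jetchev direction at this frame (`d_K ≡ 1 (mod 8)`)
  intro hfin hPinf
  haveI : Finite (W.baseChange K).sha := hfin
  -- `d_K ≠ −3` (`3 ∣ N_E` splits in `K`) and `d_K ≠ −4` (`d_K` odd)
  have h3N : 3 ∣ W.conductorNorm ℤ := dvd_conductorNorm_of_classX11b hX
  have hpd' : ¬ ((3 : ℕ) : ℤ) ∣ NumberField.discr K :=
    not_dvd_discr_of_satisfiesHeegnerHypothesis hK hHN Nat.prime_three h3N
  have h3 : NumberField.discr K ≠ -3 := by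
    intro h; apply hpd'; rw [h]; exact ⟨-1, by norm_num⟩
  have h4 : NumberField.discr K ≠ -4 := by
    intro h; have := Int.odd_iff.mp hodd; omega
  -- a conductor-1 Kolyvagin–Heegner datum on the frame (Dt, H.β, ι) (Darmon 2004, Thm. 3.6)
  obtain ⟨d₁⟩ := exists_kolyvaginHeegnerData_one (hD36 _ W K) hK Dt H.β ι H.dvd_sq_sub
  -- the bottom point: P(1) = y_K = P in E(K̄) (Shimura reciprocity at conductor 1)
  have hPd : d₁.toGeomPoints d₁.derivedPoint = toGeomPoints (W.baseChange K) P :=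
    KolyvaginBottom.toGeomPoints_derivedPoint_one_eq (hrec _ W K) hK hHN hP d₁ rfl
  -- rank one (Kolyvagin) and no 3-torsion (E[3] irreducible, K imaginary quadratic)
  obtain ⟨hrank, -⟩ := hKo (W.conductorNorm ℤ) W K hK hHN ⟨Dt, H, ι, hP⟩ hPinf
  have hbot := torsionBy_eq_bot_of_isImaginaryQuadratic_of_hasIrreducibleModPGaloisRep W K hK
    Nat.prime_three hirr
  have hiv : ∀ x : (W.baseChange K).toAffine.Point, 3 • x = 0 → x = 0 := fun x hx ↦ by
    have hmem : x ∈ AddSubgroup.torsionBy (W.baseChange K).toAffine.Point ((3 : ℕ) : ℤ) := by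
      rw [mem_torsionBy_iff, natCast_zsmul]
      exact hx
    rw [hbot] at hmem
    exact hmem
  exact Koly.shaIndexBound_sharp_of_globalDivisibility_of_irreducible hChaU W K 3 (by norm_num) hmult hirr hK
    h3 h4 hHN Dt H.β ι d₁ P hPd hPinf hrank hiv
    (hJW8 K Dt H.β ι hX hns hK hHN hodd hd8 H.dvd_sq_sub hc)

/-- **MONO-carrier corner curves: `Typed.MissingUpperBoundAt W 3` from the Jetchev MAX form on `d_K ≡ 1 (mod 8)` frames** (`hmaxW8`:
for every carrier `v` and `s ≤ ord₃ c_v`, on such frames, `P_n ∈ 3^s E(K_n)` at Kolyvagin levels of index `≥ s`): if one place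
carries the whole `3`-part of `∏c` (`hmono`), the MAX form at it is the full depth. The mono branch of `residual3_of_stubs` of the line
of record, re-keyed. CONDITIONAL on `hmaxW8`, `hmono`, `hTw` and the cited facts; nothing booked. [cite: Jetchev2008, Thm. 1.4, Cor. 1.5 (shape)] -/
theorem missingUpperBoundAt_of_jetchevMaxModEightAt_of_monoCarrier [Fact (Nat.Prime 3)]
    (hGZ : ∀ (N : ℕ) [NeZero N] (W : WeierstrassCurve ℚ) (K : Type) [Field K] [NumberField K],
      gross_zagier N W K)
    (hKo : ∀ (N : ℕ) [NeZero N] (W : WeierstrassCurve ℚ) (K : Type) [Field K] [NumberField K],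
      kolyvagin N W K)
    (hGZK : rank_eq_analyticRank_of_analyticRank_le_one) (hmod : hasEntireLFunction_rat)
    (hnf : exists_isNewformOf) (hHL : HoffsteinLuo1997_exists_twist_L_one_ne_zero)
    (hMaz : mazur_not_dvd_maninConstant_of_odd)
    (hrec : ∀ (N : ℕ) [NeZero N] (W : WeierstrassCurve ℚ) (K : Type) [Field K] [NumberField K],
      heegnerPointOfConductor_one_galoisConj N W K)
    (hD36 : ∀ (N : ℕ) [NeZero N] (W : WeierstrassCurve ℚ) (K : Type) [Field K] [NumberField K],
      phi_heegnerTau_mem_singularModuliField N W K)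
    (hChaU : Cha2005.rmk25_padicValNat_card_sha_primary_add_le_of_globalDivisibility)
    (W : WeierstrassCurve ℚ) [W.IsElliptic] [W.IsGloballyMinimal] (hX : ClassX11b W 3)
    (hns : ¬ Surj W 3)
    (hmono : ∃ v : HeightOneSpectrum (𝓞 ℚ),
      padicValNat 3 W.tamagawaProduct ≤ padicValNat 3 (W.tamagawaNumberAt v))
    (hmaxW8 : ∀ [NeZero (W.conductorNorm ℤ)] (K : Type) [Field K] [NumberField K]
      (Dt : ModularParametrizationData W (W.conductorNorm ℤ)) (β : ℤ) (ι : K →+* ℂ),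
      ClassX11b W 3 → ¬ Surj W 3 →
      IsImaginaryQuadratic K → SatisfiesHeegnerHypothesis (W.conductorNorm ℤ) K →
      Odd (NumberField.discr K) → NumberField.discr K % 8 = 1 →
      (4 * (W.conductorNorm ℤ : ℤ)) ∣ β ^ 2 - NumberField.discr K → ¬ (3 : ℤ) ∣ Dt.c →
      ∀ (v : HeightOneSpectrum (𝓞 ℚ)) (s : ℕ), s ≤ padicValNat 3 (W.tamagawaNumberAt v) →
        ∀ (n : ℕ) (d : KolyvaginHeegnerData Dt β ι n), Squarefree n →
          (∀ ℓ ∈ n.primeFactors, Zhang2014.IsKolyvaginPrime (W.conductorNorm ℤ) W K 3 ℓ ∧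
            s ≤ Zhang2014.kolyvaginIndex W 3 ℓ) → Koly.PDiv d 3 s)
    (hTw : CornerTwistAt W) :
    Typed.MissingUpperBoundAt W 3 := by
  refine missingUpperBoundAt_of_jetchevMaxModEightAt_of_irreducible hGZ hKo hGZK hmod hnf hHL hMaz hrec hD36 hChaU W
    hX hns ?_ hTw
  intro _ K _ _ Dt β ι hX hns hK hHN hodd hd8 hβ hc s hs n d hn hℓ
  obtain ⟨v, hv⟩ := hmono
  exact hmaxW8 K Dt β ι hX hns hK hHN hodd hd8 hβ hc v s (hs.trans hv) n d hn hℓ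

/-! ### §3 END — the mono-carrier corner's consumed shape on PRINT -/

/-- **END: on every MONO-carrier (T4″)@3 corner curve, `Typed.MissingUpperBoundAt W 3` ⟸ {(A′) Gross 1991 Prop. 3.7 (2) =
`GrossLMS1991.prop37_2_frobeniusCongruence`, Poitou–Tate for the tree's Selmer structures, [GZ86 III (3.1)] image-free} ∪ the
consumer's cited facts ∪ {`CornerTwistAt W`}** — NO (γ)-twin def, NO `ℓ = 2` residue: `missingUpperBoundAt_of_jetchevMaxModEightAt_of_monoCarrier`
fed with `Koly.pDivThree_of_threeNamedFacts_of_discr_mod_eight` (`…UpperModEight` §4). This is the mono branch of the line of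
record's `residual3_of_stubs` with lane A's stub DISPLAYED on print. CONDITIONAL on every binder (all NAMED published facts, typed,
unformalised) and on the open input `CornerTwistAt W` (conjunct 2's object); no stub is discharged; 19111 ∕ 21420 stay OPEN;
nothing about any curve's BSD; T7. [cite: GrossLMS1991, Prop. 3.7 (2) (p. 240)] [cite: Nekovar2007, Prop. 4.13 (ii)]
[cite: HoffsteinLuo1997, Theorem (§1)] [cite: Jetchev2008, Thm. 1.4, Cor. 1.5] [cite: McCallumLMS1991, §4 Prop. 4.4, §5 Prop. 5.2]
[cite: GrossZagier1986, III (3.1)] [cite: MilneADT2006, Ch. I, Thm. 4.10(b)] [cite: Cha2005, Rmk. 25] -/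
theorem missingUpperBoundAt_monoCarrier_of_threeNamedFacts_of_facts [Fact (Nat.Prime 3)]
    -- the THREE named Literature facts of the Kolyvagin road
    (h37 : GrossLMS1991.prop37_2_frobeniusCongruence)
    (hPTc : ∀ (K : Type) [Field K] [NumberField K], poitouTate_selmerStructure_duality_conj K)
    (hF1 : Gross1991_heegnerPoint_sub_ratTorsion_mem_E0_imageFree)
    -- the consumer's cited facts
    (hGZ : ∀ (N : ℕ) [NeZero N] (W : WeierstrassCurve ℚ) (K : Type) [Field K] [NumberField K],
      gross_zagier N W K)
    (hKo : ∀ (N : ℕ) [NeZero N] (W : WeierstrassCurve ℚ) (K : Type) [Field K] [NumberField K],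
      kolyvagin N W K)
    (hGZK : rank_eq_analyticRank_of_analyticRank_le_one) (hmod : hasEntireLFunction_rat)
    (hnf : exists_isNewformOf) (hHL : HoffsteinLuo1997_exists_twist_L_one_ne_zero)
    (hMaz : mazur_not_dvd_maninConstant_of_odd)
    (hrec : ∀ (N : ℕ) [NeZero N] (W : WeierstrassCurve ℚ) (K : Type) [Field K] [NumberField K],
      heegnerPointOfConductor_one_galoisConj N W K)
    (hD36 : ∀ (N : ℕ) [NeZero N] (W : WeierstrassCurve ℚ) (K : Type) [Field K] [NumberField K],
      phi_heegnerTau_mem_singularModuliField N W K)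
    (hChaU : Cha2005.rmk25_padicValNat_card_sha_primary_add_le_of_globalDivisibility)
    -- the curve: a MONO-carrier (T4″)@3 corner curve (the binder `3 ∣ ∏c` of `residual3_of_stubs` is not needed), and conjunct 2
    (W : WeierstrassCurve ℚ) [W.IsElliptic] [W.IsGloballyMinimal] (hX : ClassX11b W 3)
    (hns : ¬ Surj W 3)
    (hmono : ∃ v : HeightOneSpectrum (𝓞 ℚ),
      padicValNat 3 W.tamagawaProduct ≤ padicValNat 3 (W.tamagawaNumberAt v))
    (hTw : CornerTwistAt W) :
    Typed.MissingUpperBoundAt W 3 :=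
  missingUpperBoundAt_of_jetchevMaxModEightAt_of_monoCarrier hGZ hKo hGZK hmod hnf hHL hMaz hrec hD36 hChaU W hX hns hmono
    (fun K _ _ Dt β ι hX hns hK hHN hodd hd8 hβ hc v s hs n d hn hℓ ↦
      Koly.pDivThree_of_threeNamedFacts_of_discr_mod_eight h37 hPTc hF1 W K Dt β ι hX hns hK hHN hodd hd8 hβ hc
        v s hs n d hn hℓ)
    hTw

end Summit.BirchSwinnertonDyer.Rank1Residual.X11b.Three

end
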